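import Summits.ResolutionOfSingularities.ResolutionOfSingularities.Theorems.EquisingularLiftEquisingularLiftNatSingularVectors
import Summits.ResolutionOfSingularities.ResolutionOfSingularities.Theorems.EquisingularLiftEquisingularLiftNatELNatAtOneStepPointsLinAut
import Summits.ResolutionOfSingularities.ResolutionOfSingularities.Theorems.EquisingularLiftEquisingularLiftBlowupModelOneStepPointsLinAut
import HarnessLib

/-!
# [OURS] SINGULAR VECTORS ⟹ BOTH ROUTE CURRENCIES: EL♮ (`ELNatAt`) and regular blow-up models for hypersurfaces whose singular VECTORS are finitely many
# one-step / first-order points in arbitrary position — polynomial hypotheses only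
# (cruxes `Theses.EquisingularLift.EquisingularLift{,Nat,NatThree}`, stmt-ResolutionOfSingularities-15660 / -20038 / -20148)

[OURS · leafhand-res-equisingularlift-10 g1, 2026-08-31; cell `pub/decomp-res`] AI-produced, weaker than expert review; NOT a statement of any manuscript;
nothing here proves resolution of singularities in positive characteristic.  DEF-FREE helper; no `sorry`; standard axioms; ZERO named hypotheses.

✓ `SingLocus.isRegularLocalRing_stalk_of_singularVectors` (this hand, `…NatSingularVectors`) turns the VECTOR Jacobian hypothesis «every non-zero `b` with
`F(b) = 0`, `∇F(b) = 0` is killed by the linear forms `ℓ_a = linSubst ↑g (x_a)`, `a ≠ c`, of some listed `(g, c)`» into the stalk hypothesis `hreg` of the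
lh10 capstones.  Here that substitution is made once (`isRegularLocalRing_stalk_of_singularVectors_linAut`) and fed to every currency:

* ★★ `SingLocus.isRegularLocalRing_stalk_of_singularVectors_linAut` — `hreg` of ✓ `isoHypPoint_of_oneStepPoints_linAut` & co. from the vector hypothesis;
* ★★★ `elNatAt_of_singularVectors_oneStep_linAut` — **EL♮ (`Theorems.EquisingularLift.ELNatAt p K (m+2) V₊(F) ι`) for every prime form `F` over `K = K̄` of
  characteristic `p` whose singular vectors are finitely many points carrying, in per-point linear coordinates, seat res-D-pv-013's ONE-STEP datum (`μ ≥ 2`)**;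
* ★★★ `elNatAt_of_singularVectors_firstOrder_linAut` — the same from hand 9's FIRST-ORDER data (ordinary multiple points, `A₂`, char-2 nodes, …);
* ★★★ `StrataSplit.blowupModel_of_singularVectors_oneStep_linAut` / `…_of_range_eq_…` — the 15660 currency: a regular blow-up model for `V₊(F)` and for every
  binder `(H, ι)` with `range ι = V₊(F)` (the conclusion of the OPEN residual `stub_blowupModel_ge_five` at these `H`), `K = K̄` of any characteristic.

Every hypothesis is now a statement about polynomials over `K` (forms, primality, chart splittings, Jacobian vectors): no scheme point, stalk or ideal sheaf
is quantified over in the hypotheses.  Honest label: closes no registered stub.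

References: [Hartshorne1977, I Thm. 5.1, I Ex. 5.8, II Example 7.1.1, II Ex. 7.12]; [Matsumura1987, Thm. 14.2]; [StacksProject, Tags 080A, 080E] — through
the cited tree files.
-/

set_option linter.dupNamespace false -- mandated namespace `Summit.<Summit>.<Problem>` of this single-conjunct summit

noncomputable section

open CategoryTheory CategoryTheory.Limits AlgebraicGeometry TopologicalSpace
open MvPolynomial HomogeneousLocalization
open Literature.AlgebraicGeometry.Resolution Literature.AlgebraicGeometry.Motives Literature.AlgebraicGeometry.GroupSchemes
open Literature.AlgebraicGeometry.Motives.SmoothHypersurface Literature.AlgebraicGeometry.Motives.ProjectiveSpace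
open AlgebraicGeometry.Scheme.IdealSheafData
open Summit.ResolutionOfSingularities.ResolutionOfSingularities.Cruxes.EquisingularLift.StrataSplit

namespace Summit.ResolutionOfSingularities.ResolutionOfSingularities.Cruxes.EquisingularLiftNat.Sections

namespace SingLocus

/-- ★★ **`hreg` from the vector Jacobian hypothesis**: `F` a prime form over `K = K̄`, `pts` a list of linear coordinates `(g, c)`; if every non-zero singular
vector of `F` is killed by the `ℓ_a = linSubst ↑g (x_a)`, `a ≠ c`, of some listed `(g, c)`, then `V₊(F)` is regular at every point which is none of the
`α_g⁻¹(P_c)` (✓ `isRegularLocalRing_stalk_of_singularVectors` with `V = {g⁻¹ e_c}`). [OURS] [cite: Hartshorne1977, I Thm. 5.1] [cite: Matsumura1987, Thm. 14.2] -/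
theorem isRegularLocalRing_stalk_of_singularVectors_linAut (K : Type) [Field K] [IsAlgClosed K] {m : ℕ} (F : MvPolynomial (Fin (m + 2 + 1)) K) {d : ℕ}
    (hF : F.IsHomogeneous d) (hFp : Prime F) (pts : List (GL (Fin (m + 2 + 1)) K × Fin (m + 2 + 1)))
    (hjac : ∀ b : Fin (m + 2 + 1) → K, b ≠ 0 → eval b F = 0 → (∀ i, eval b (pderiv i F) = 0) →
      ∃ gc ∈ pts, ∀ a : Fin (m + 2 + 1), a ≠ gc.2 →
        eval b (ProjLinAction.linSubst K (gc.1 : Matrix (Fin (m + 2 + 1)) (Fin (m + 2 + 1)) K) (X a)) = 0) :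
    letI := MvPolynomial.gradedAlgebra (σ := Fin (m + 2 + 1)) (R := K)
    ∀ x : ↥(hypersurface F).left, (∀ gc ∈ pts, ¬ (∀ a : Fin (m + 2 + 1), a ≠ gc.2 →
      ProjLinAction.linSubst K (gc.1 : Matrix (Fin (m + 2 + 1)) (Fin (m + 2 + 1)) K) (X a) ∈ ((hypersurfaceι F).left x).asHomogeneousIdeal)) →
      IsRegularLocalRing ((hypersurface F).left.presheaf.stalk x) := by
  letI := MvPolynomial.gradedAlgebra (σ := Fin (m + 2 + 1)) (R := K)
  classical
  intro x hx
  let vec : GL (Fin (m + 2 + 1)) K × Fin (m + 2 + 1) → (Fin (m + 2 + 1) → K) := fun gc =>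
    ((gc.1⁻¹ : GL (Fin (m + 2 + 1)) K) : Matrix (Fin (m + 2 + 1)) (Fin (m + 2 + 1)) K).mulVec (Pi.single gc.2 (1 : K))
  refine isRegularLocalRing_stalk_of_singularVectors K F hF hFp (pts.map vec).toFinset ?_ x ?_
  · intro b hb hFb hdFb
    obtain ⟨gc, hgc, hb0⟩ := hjac b hb hFb hdFb
    exact ⟨vec gc, List.mem_toFinset.mpr (List.mem_map.mpr ⟨gc, hgc, rfl⟩),
      ((gc.1 : Matrix (Fin (m + 2 + 1)) (Fin (m + 2 + 1)) K).mulVec b) gc.2, eq_smul_vec_of_forall_eval_eq_zero K gc.1 gc.2 b hb0⟩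
  · intro v hv
    obtain ⟨gc, hgc, rfl⟩ := List.mem_map.mp (List.mem_toFinset.mp hv)
    have hx' := hx gc hgc
    push Not at hx'
    obtain ⟨a, hac, ha⟩ := hx'
    exact ⟨ProjLinAction.linSubst K (gc.1 : Matrix (Fin (m + 2 + 1)) (Fin (m + 2 + 1)) K) (X a),
      isHomogeneous_one_linSubst_X K _ a, eval_linSubst_X_vec_eq_zero K gc.1 gc.2 a hac, ha⟩

end SingLocus

/-! ## EL♮ currency (cruxes 20038 / 20148) -/

/-- ★★★ **EL♮ FOR EVERY HYPERSURFACE WHOSE SINGULAR VECTORS ARE ONE-STEP POINTS — polynomial hypotheses only** (`K = K̄` of characteristic `p`, every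
dimension, any number of points, any position): `Theorems.EquisingularLift.ELNatAt p K (m+2) V₊(F) ι`.  ✓ `elNatAt_of_singularOneStepPoints_linAut` with `hreg`
discharged by `SingLocus.isRegularLocalRing_stalk_of_singularVectors_linAut`. [OURS] [cite: Hartshorne1977, I Thm. 5.1, II Example 7.1.1] [cite: StacksProject, Tag 080E] -/
theorem elNatAt_of_singularVectors_oneStep_linAut (p : ℕ) (hp : p.Prime) (K : Type) [Field K] [CharP K p] [IsAlgClosed K] {m : ℕ}
    (F : MvPolynomial (Fin (m + 2 + 1)) K) {d : ℕ} (hF : F.IsHomogeneous d) (hFp : Prime F) (pts : List (GL (Fin (m + 2 + 1)) K × Fin (m + 2 + 1)))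
    (hone : ∀ gc ∈ pts,
      (ProjLinAction.linSubst K ((gc.1⁻¹ : GL (Fin (m + 2 + 1)) K) : Matrix (Fin (m + 2 + 1)) (Fin (m + 2 + 1)) K) F).IsHomogeneous d ∧
      Prime (ProjLinAction.linSubst K ((gc.1⁻¹ : GL (Fin (m + 2 + 1)) K) : Matrix (Fin (m + 2 + 1)) (Fin (m + 2 + 1)) K) F) ∧
      ∃ (μ : ℕ) (Φ Ψ : MvPolynomial (Fin (m + 2)) K), 2 ≤ μ ∧ Φ.IsHomogeneous μ ∧ Φ ≠ 0 ∧
        Ψ ∈ Ideal.span (Set.range (X : Fin (m + 2) → MvPolynomial (Fin (m + 2)) K)) ^ (μ + 1) ∧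
        ProjectiveSpace.dehomogenize K gc.2 (ProjLinAction.linSubst K ((gc.1⁻¹ : GL (Fin (m + 2 + 1)) K) :
          Matrix (Fin (m + 2 + 1)) (Fin (m + 2 + 1)) K) F) = Φ + Ψ ∧
        ∀ l : Fin (m + 2), ∃ G : MvPolynomial (Fin (m + 2)) K,
          aeval (fun j => X l * Function.update (X : Fin (m + 2) → MvPolynomial (Fin (m + 2)) K) l 1 j) (Φ + Ψ) = X l ^ μ * G ∧
          ∀ P : Ideal (MvPolynomial (Fin (m + 2)) K), P.IsPrime → (X l : MvPolynomial (Fin (m + 2)) K) ∈ P → G ∈ P → ∃ j, pderiv j G ∉ P)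
    (hjac : ∀ b : Fin (m + 2 + 1) → K, b ≠ 0 → eval b F = 0 → (∀ i, eval b (pderiv i F) = 0) →
      ∃ gc ∈ pts, ∀ a : Fin (m + 2 + 1), a ≠ gc.2 →
        eval b (ProjLinAction.linSubst K (gc.1 : Matrix (Fin (m + 2 + 1)) (Fin (m + 2 + 1)) K) (X a)) = 0) :
    letI := MvPolynomial.gradedAlgebra (σ := Fin (m + 2 + 1)) (R := K)
    Theorems.EquisingularLift.ELNatAt p K (m + 2) (hypersurface F).left (hypersurfaceι F).left :=
  elNatAt_of_singularOneStepPoints_linAut p hp K F hF hFp pts hone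
    (SingLocus.isRegularLocalRing_stalk_of_singularVectors_linAut K F hF hFp pts hjac)

/-- ★★★ **EL♮ FOR EVERY HYPERSURFACE WHOSE SINGULAR VECTORS ARE FIRST-ORDER POINTS — polynomial hypotheses only** (`K = K̄` of characteristic `p`; hand 9's
intrinsic first-order criterion in per-point linear coordinates, multiplicity `μ ≥ 2`; ordinary multiple points, `A₂` points, characteristic-2 nodes …).
✓ `elNatAt_of_singularFirstOrderPoints_linAut` with `hreg` discharged. [OURS] [cite: Hartshorne1977, I Thm. 5.1, I Ex. 5.8] -/
theorem elNatAt_of_singularVectors_firstOrder_linAut (p : ℕ) (hp : p.Prime) (K : Type) [Field K] [CharP K p] [IsAlgClosed K] {m : ℕ}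
    (F : MvPolynomial (Fin (m + 2 + 1)) K) {d : ℕ} (hF : F.IsHomogeneous d) (hFp : Prime F) (pts : List (GL (Fin (m + 2 + 1)) K × Fin (m + 2 + 1)))
    (hfo : ∀ gc ∈ pts,
      (ProjLinAction.linSubst K ((gc.1⁻¹ : GL (Fin (m + 2 + 1)) K) : Matrix (Fin (m + 2 + 1)) (Fin (m + 2 + 1)) K) F).IsHomogeneous d ∧
      Prime (ProjLinAction.linSubst K ((gc.1⁻¹ : GL (Fin (m + 2 + 1)) K) : Matrix (Fin (m + 2 + 1)) (Fin (m + 2 + 1)) K) F) ∧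
      ∃ (μ : ℕ) (Φ Ψ₁ Ψ' : MvPolynomial (Fin (m + 2)) K), 2 ≤ μ ∧ Φ.IsHomogeneous μ ∧ Φ ≠ 0 ∧ Ψ₁.IsHomogeneous (μ + 1) ∧
        Ψ' ∈ Ideal.span (Set.range (X : Fin (m + 2) → MvPolynomial (Fin (m + 2)) K)) ^ (μ + 2) ∧
        ProjectiveSpace.dehomogenize K gc.2 (ProjLinAction.linSubst K ((gc.1⁻¹ : GL (Fin (m + 2 + 1)) K) :
          Matrix (Fin (m + 2 + 1)) (Fin (m + 2 + 1)) K) F) = Φ + (Ψ₁ + Ψ') ∧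
        ∀ P : Ideal (MvPolynomial (Fin (m + 2)) K), P.IsPrime → Φ ∈ P → (∀ i, pderiv i Φ ∈ P) → Ψ₁ ∈ P →
          ∀ i, (X i : MvPolynomial (Fin (m + 2)) K) ∈ P)
    (hjac : ∀ b : Fin (m + 2 + 1) → K, b ≠ 0 → eval b F = 0 → (∀ i, eval b (pderiv i F) = 0) →
      ∃ gc ∈ pts, ∀ a : Fin (m + 2 + 1), a ≠ gc.2 →
        eval b (ProjLinAction.linSubst K (gc.1 : Matrix (Fin (m + 2 + 1)) (Fin (m + 2 + 1)) K) (X a)) = 0) :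
    letI := MvPolynomial.gradedAlgebra (σ := Fin (m + 2 + 1)) (R := K)
    Theorems.EquisingularLift.ELNatAt p K (m + 2) (hypersurface F).left (hypersurfaceι F).left :=
  elNatAt_of_singularFirstOrderPoints_linAut p hp K F hF hFp pts hfo
    (SingLocus.isRegularLocalRing_stalk_of_singularVectors_linAut K F hF hFp pts hjac)

end Summit.ResolutionOfSingularities.ResolutionOfSingularities.Cruxes.EquisingularLiftNat.Sections

/-! ## Regular blow-up models (crux 15660) -/

namespace Summit.ResolutionOfSingularities.ResolutionOfSingularities.Cruxes.EquisingularLift.StrataSplit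

open Summit.ResolutionOfSingularities.ResolutionOfSingularities.Cruxes.EquisingularLiftNat.Sections

/-- ★★★ **A REGULAR BLOW-UP MODEL FOR EVERY HYPERSURFACE WHOSE SINGULAR VECTORS ARE ONE-STEP POINTS — polynomial hypotheses only** (`K = K̄` of any
characteristic, every dimension): `F` a prime form; per-point linear coordinates `(g, c)` with the ONE-STEP datum (`μ ≥ 1`) at `P_c`; every non-zero singular
vector of `F` killed by the `ℓ_a`, `a ≠ c`, of some listed `(g, c)` ⟹ `∃ 𝔞 ≠ ⊥` on `V₊(F)` all of whose blow-ups are regular — the conclusion of the OPEN residual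
`stub_blowupModel_ge_five` at these `H`.  ✓ `blowupModel_oneStepPoints_linAut` with `hreg` discharged.
[OURS] [cite: Hartshorne1977, I Thm. 5.1, II Example 7.1.1, II Ex. 7.12] [cite: StacksProject, Tags 080A, 0804] -/
theorem blowupModel_of_singularVectors_oneStep_linAut (K : Type) [Field K] [IsAlgClosed K] {m : ℕ} (F : MvPolynomial (Fin (m + 2 + 1)) K) {d : ℕ}
    (hF : F.IsHomogeneous d) (hFp : Prime F) (pts : List (GL (Fin (m + 2 + 1)) K × Fin (m + 2 + 1)))
    (hone : ∀ gc ∈ pts,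
      (ProjLinAction.linSubst K ((gc.1⁻¹ : GL (Fin (m + 2 + 1)) K) : Matrix (Fin (m + 2 + 1)) (Fin (m + 2 + 1)) K) F).IsHomogeneous d ∧
      Prime (ProjLinAction.linSubst K ((gc.1⁻¹ : GL (Fin (m + 2 + 1)) K) : Matrix (Fin (m + 2 + 1)) (Fin (m + 2 + 1)) K) F) ∧
      ∃ (μ : ℕ) (Φ Ψ : MvPolynomial (Fin (m + 2)) K), 1 ≤ μ ∧ Φ.IsHomogeneous μ ∧ Φ ≠ 0 ∧
        Ψ ∈ Ideal.span (Set.range (X : Fin (m + 2) → MvPolynomial (Fin (m + 2)) K)) ^ (μ + 1) ∧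
        ProjectiveSpace.dehomogenize K gc.2 (ProjLinAction.linSubst K ((gc.1⁻¹ : GL (Fin (m + 2 + 1)) K) :
          Matrix (Fin (m + 2 + 1)) (Fin (m + 2 + 1)) K) F) = Φ + Ψ ∧
        ∀ l : Fin (m + 2), ∃ G : MvPolynomial (Fin (m + 2)) K,
          aeval (fun j => X l * Function.update (X : Fin (m + 2) → MvPolynomial (Fin (m + 2)) K) l 1 j) (Φ + Ψ) = X l ^ μ * G ∧
          ∀ P : Ideal (MvPolynomial (Fin (m + 2)) K), P.IsPrime → (X l : MvPolynomial (Fin (m + 2)) K) ∈ P → G ∈ P → ∃ j, pderiv j G ∉ P)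
    (hjac : ∀ b : Fin (m + 2 + 1) → K, b ≠ 0 → eval b F = 0 → (∀ i, eval b (pderiv i F) = 0) →
      ∃ gc ∈ pts, ∀ a : Fin (m + 2 + 1), a ≠ gc.2 →
        eval b (ProjLinAction.linSubst K (gc.1 : Matrix (Fin (m + 2 + 1)) (Fin (m + 2 + 1)) K) (X a)) = 0) :
    letI := MvPolynomial.gradedAlgebra (σ := Fin (m + 2 + 1)) (R := K)
    ∃ 𝔞 : ((hypersurface F).left).IdealSheafData, 𝔞 ≠ ⊥ ∧
      ∀ (Z : Scheme.{0}) (π : Z ⟶ (hypersurface F).left), IsBlowup π 𝔞 → Scheme.IsRegular Z :=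
  blowupModel_oneStepPoints_linAut K F hF hFp pts hone
    (SingLocus.isRegularLocalRing_stalk_of_singularVectors_linAut K F hF hFp pts hjac)

/-- ★ **The same for every binder `(H, ι)` of crux `EquisingularLift` with `range ι = V₊(F)`** (✓ `blowupModel_of_range_eq_oneStepPoints_linAut` with `hreg`
discharged). [OURS] [cite: Hartshorne1977, II Ex. 7.12] -/
theorem blowupModel_of_range_eq_singularVectors_oneStep_linAut (K : Type) [Field K] [IsAlgClosed K] {m : ℕ} (F : MvPolynomial (Fin (m + 2 + 1)) K) {d : ℕ}
    (hF : F.IsHomogeneous d) (hFp : Prime F) (pts : List (GL (Fin (m + 2 + 1)) K × Fin (m + 2 + 1)))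
    (hone : ∀ gc ∈ pts,
      (ProjLinAction.linSubst K ((gc.1⁻¹ : GL (Fin (m + 2 + 1)) K) : Matrix (Fin (m + 2 + 1)) (Fin (m + 2 + 1)) K) F).IsHomogeneous d ∧
      Prime (ProjLinAction.linSubst K ((gc.1⁻¹ : GL (Fin (m + 2 + 1)) K) : Matrix (Fin (m + 2 + 1)) (Fin (m + 2 + 1)) K) F) ∧
      ∃ (μ : ℕ) (Φ Ψ : MvPolynomial (Fin (m + 2)) K), 1 ≤ μ ∧ Φ.IsHomogeneous μ ∧ Φ ≠ 0 ∧
        Ψ ∈ Ideal.span (Set.range (X : Fin (m + 2) → MvPolynomial (Fin (m + 2)) K)) ^ (μ + 1) ∧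
        ProjectiveSpace.dehomogenize K gc.2 (ProjLinAction.linSubst K ((gc.1⁻¹ : GL (Fin (m + 2 + 1)) K) :
          Matrix (Fin (m + 2 + 1)) (Fin (m + 2 + 1)) K) F) = Φ + Ψ ∧
        ∀ l : Fin (m + 2), ∃ G : MvPolynomial (Fin (m + 2)) K,
          aeval (fun j => X l * Function.update (X : Fin (m + 2) → MvPolynomial (Fin (m + 2)) K) l 1 j) (Φ + Ψ) = X l ^ μ * G ∧
          ∀ P : Ideal (MvPolynomial (Fin (m + 2)) K), P.IsPrime → (X l : MvPolynomial (Fin (m + 2)) K) ∈ P → G ∈ P → ∃ j, pderiv j G ∉ P)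
    (hjac : ∀ b : Fin (m + 2 + 1) → K, b ≠ 0 → eval b F = 0 → (∀ i, eval b (pderiv i F) = 0) →
      ∃ gc ∈ pts, ∀ a : Fin (m + 2 + 1), a ≠ gc.2 →
        eval b (ProjLinAction.linSubst K (gc.1 : Matrix (Fin (m + 2 + 1)) (Fin (m + 2 + 1)) K) (X a)) = 0)
    {H : Scheme.{0}} (ι : H ⟶ (projectiveSpace (m + 2) K).left) [IsClosedImmersion ι] [IsIntegral H]
    (hrange : letI := MvPolynomial.gradedAlgebra (σ := Fin (m + 2 + 1)) (R := K)
      Set.range ι = {x : Proj (homogeneousSubmodule (Fin (m + 2 + 1)) K) | F ∈ x.asHomogeneousIdeal}) :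
    ∃ 𝔞 : H.IdealSheafData, 𝔞 ≠ ⊥ ∧ ∀ (Z : Scheme.{0}) (π : Z ⟶ H), IsBlowup π 𝔞 → Scheme.IsRegular Z :=
  blowupModel_of_range_eq_oneStepPoints_linAut K F hF hFp pts hone
    (SingLocus.isRegularLocalRing_stalk_of_singularVectors_linAut K F hF hFp pts hjac) ι hrange

end Summit.ResolutionOfSingularities.ResolutionOfSingularities.Cruxes.EquisingularLift.StrataSplit

end
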